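import Mathlib.Analysis.Matrix.HermitianFunctionalCalculus
import Mathlib.Analysis.CStarAlgebra.Matrix
import Literature.MathematicalPhysics.QuantumLattice.GrassmannIntegralGaussianProofs
import Literature.MathematicalPhysics.QuantumFieldTheory.QCDOS
import HarnessLib

/-!
# Admissible-overlap lattice QCD: the twins of the `QCDOS` functionals

Definition request `defn-overlapTorusExpect` of route `QuantumFields/QCD/OverlapPositivityTransfer`:
the lattice functionals of `QCDOS.lean` (`fermiBoltzmann`, `qcdTorusExpect`, `qcdLatticeConnectedCorr`,
`QCDScheme.HasLatticeMassGap`, `qcdLatticeSchwinger`, `IsQCDAlong`, and the shape of `QCDOf`) with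
Wilson's regularisation replaced by ADMISSIBLE-OVERLAP lattice QCD — `N_f` flavours of massive
Neuberger overlap quarks `D_μ = (1 + μ/2)·1 + (1 − μ/2)·Γ₅ sign(Γ₅ D_W(U, −1, 1))` (`m₀ = r = 1`,
`SU(3)` fundamental, matrix sign = Mathlib's `cfc Real.sign`; `qcdOverlapDirac`), and the product
Haar measure weighted by the admissibility-constrained plaquette weight
`∏ₚ 1[tₚ < 1/1800] exp(−β tₚ/(1 − 1800 tₚ))`, `tₚ = 3 − Re tr Uₚ` (`overlapGaugeCut/Weight`; the
trace form of `‖1 − Uₚ‖ < 1/30`). Everything else (`fermiIntegral`, `QCDField`, `smearedInsertion`,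
`QCDLatticeObservable.onTorus`, `QCDScheme`, `QCDRegularisation`, `OSData`) is shared with `QCDOS`.

By construction the definitions are DEFINITIONALLY EQUAL to the `let`-bound terms of the route file
`Summits/QuantumFields/QCD/Theses/OverlapPositivityTransfer.lean`, so its items restate by name
(`Iff.rfl`, checked against all six items at filing): `ovD S U μ ≡ qcdOverlapDirac U μ`,
`w β S U ≡ ((overlapGaugeWeight β U : ℝ) : ℂ)`, `B S μ U ≡ overlapBoltzmann U μ`,
`ovE ≡ overlapTorusExpect`, `OvGap ≡ QCDScheme.OverlapHasLatticeMassGap`,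
`OvAlong ≡ IsOverlapQCDAlong`, `GapPkg ≡ OverlapGapPackage Nf`, `Ov ≡ OverlapQCDOf Nf`.

API proved: the weight is supported on the admissible set, lies in `[0, 1]` for `β ≥ 0` and is
gauge invariant; `det D(U) = ∏_f det D_{μ_f}(U)`; the Gaussian Berezin evaluation
`fermiIntegral_overlapBoltzmann` (clause (ii) of the route item `OverlapMeasurePositivity`) and
`overlapPartitionFn_eq`; `⟨1⟩ = 1`, homogeneity; non-vacuity of `IsOverlapQCDAlong`. NOT here (route
items): `Z > 0` for `β ≥ 0`, `μ_f > 0`; `det D_μ > 0`; `|⟨A⟩|` bounds. The general-parameter notions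
`overlapDirac` / `admissiblePlaquetteWeight` are separate requests; the instances here are the
ones defeq to the route.

THE CHIRAL POINT (statement re-type 2026-08-16, p117723: `QCDOf N_f` conjoins
`reg.IsChiralAtZero`, pinning the flavour-blind additive offset of `m_crit` to the chiral point by
demanding that the lattice gap close as `m → 0⁺`). Section `ChiralPoint` adds the overlap twins:
`QCDRegularisation.OverlapIsChiralAtZero` (the literal twin), its subsequence-stable strengthening
`QCDRegularisation.OverlapGapClosesAtZero` (the gap bound fails EVENTUALLY in `k`, not only
frequently — what a continuum-limit reindexing preserves), the positive-mass body
`QCDRegularisation.HasOverlapGapAtPositiveMass`, and the packages `OverlapChiralQCDOf N_f` (twin of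
the re-typed `QCDOf N_f`, strong chiral clause) and `OverlapChiralGapPackage N_f`; `OverlapQCDOf` /
`OverlapGapPackage` keep their pre-re-type meaning and are the forgetful images
(`OverlapChiralQCDOf.overlapQCDOf`, `OverlapChiralGapPackage.overlapGapPackage`). In the overlap
world the chiral point is CANONICAL: Lüscher's exact flavoured chiral symmetry at `μ = 0` forbids an
additive mass renormalisation, and the exact flavoured Ward identity
`G_ab(p = 0) = δ_ab ⟨Ψ̄(1 − aD/2)Ψ⟩/(m a⁴)` (Chandrasekharan §3) turns "the gap closes as `μ → 0⁺`"
into Goldstone's alternative "no chirally symmetric gapped phase" — the route's crux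
`OverlapGoldstone` is stated over `OverlapGapClosesAtZero` with `m_crit ≡ 0`.

Sources (arXiv versions read 2026-08-15; precise locators on each declaration): Neuberger, PLB
417 (1998) 141, eqs. (8)–(10); Hernández–Jansen–Lüscher, NPB 552 (1999) 363, eq. (1.2),
(2.15)–(2.16), §2.5; Giusti–Hoelbling–Lüscher–Wittig, CPC 153 (2003) 31, §3 (`D_m = (1 − ām/2)D + m`,
`0 ≤ ām ≤ 2`, `D = ā⁻¹{1 + γ₅ sign(Q)}`, `Q = γ₅(aD_w − 1 − s)`: at `a = 1`, `s = 0` literally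
`qcdOverlapDirac`); Lüscher, NPB 549 (1999) 295, §2 (2.5)–(2.6), (2.9); Fukaya et al. (JLQCD),
PRD 74 (2006) 094505, §2 eq. (2) (the `SU(3)` trace-form action; ours is `ε' = 1/5400`, `β' = 3β` in
their normalisation, the tree's `β = β_W/3` of `qcdGaugeMeasure_eq`); Osterwalder–Seiler 1978 and
Montvay–Münster 1994 §4.1, §5.1 (Berezin-integrated lattice QCD, as in `QCDOS`); Lüscher, PLB 428 (1998) 342, §4 eq. (4.1) (exact lattice chiral symmetry of GW fermions) and
Chandrasekharan, PRD 60 (1999) 074503, §3 (flavoured Ward identity and Goldstone's theorem for GW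
fermions) for the chiral-point clauses.
-/

open scoped SchwartzMap
open MeasureTheory Filter Topology
open Literature.MathematicalPhysics.AQFT Literature.Probability.LatticeModels Literature.MathematicalPhysics.QuantumLattice

noncomputable section

namespace Literature.MathematicalPhysics.QuantumFieldTheory

local notation "𝔾" => Matrix.specialUnitaryGroup (Fin 3) ℂ

section OneTorus

variable {Nf S : ℕ} [NeZero S]

/-! ### Overlap quarks -/

/-- **The massive Neuberger overlap Dirac operator of lattice QCD** on the four-torus of side `S` in
the `SU(3)` background `U` (fundamental rep), projection point `m₀ = 1`, Wilson parameter `r = 1`,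
bare mass `μ` (lattice units):
`D_μ(U) = (1 + μ/2)·1 + (1 − μ/2)·Γ₅ sign(Γ₅ D_W(U, −1, 1))`, `Γ₅ = spinorLift gammaFive`,
`D_W` the tree's `wilsonDirac`, `sign` the matrix sign function (Mathlib's continuous functional
calculus `cfc Real.sign` of the kernel `Γ₅ D_W`, hermitian for unitary `ρ` by the tree fact
`wilsonDirac_gammaFive_hermitian`). At `μ = 0` this is the Neuberger–Dirac operator
`D = ā⁻¹{1 + γ₅ sign(Q)}`, `Q = γ₅(aD_w − 1 − s)` at `a = 1`, `s = 0` (Neuberger's `1 + V`,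
`V = Γ₅ ε(H)`; HJL's `1 − A(A†A)^{−1/2}`, `A = 1 − D_w`; spectrum on the GW circle `|z − 1| = 1`),
and `D_μ` is the standard massive operator `D_m = (1 − ām/2) D + m`, `0 ≤ ām ≤ 2`. The term is
the `let ovD` of the route `OverlapPositivityTransfer` (fixed `SU(3)`, `m₀ = r = 1`).
[cite: GiustiEtAl2002, §3 (D_m = (1 − ām/2)D + m over D = ā⁻¹{1 + γ₅ sign(Q)}, Q = γ₅(aD_w − 1 − s))] [cite: Neuberger1998, eqs. (8)–(10)] [cite: HernandezJansenLuscher1999, eq. (1.2)] -/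
def qcdOverlapDirac (U : GaugeConfig 4 S 𝔾) (μ : ℝ) :
    Matrix (TorusSite 4 S × Fin 3 × Fin 4) (TorusSite 4 S × Fin 3 × Fin 4) ℂ :=
  ((1 + μ / 2 : ℝ) : ℂ) •
      (1 : Matrix (TorusSite 4 S × Fin 3 × Fin 4) (TorusSite 4 S × Fin 3 × Fin 4) ℂ) +
    ((1 - μ / 2 : ℝ) : ℂ) •
      (spinorLift gammaFive *
        cfc Real.sign (spinorLift gammaFive * wilsonDirac (fundamentalRep (Fin 3)) U (-1) 1))

/-- **The `N_f`-flavour overlap fermion matrix** `D(U) = ⊕_f D_{μ_f}(U)` (flavour-diagonal,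
reindexed by the tree's enumeration `quarkEquiv` of the quark variables) — the overlap twin of
`diracMatrix`. [cite: GiustiEtAl2002, §3 (massive Neuberger–Dirac operator)] [cite: MontvayMunster1994, §5.1] -/
def overlapDiracMatrix (U : GaugeConfig 4 S 𝔾) (μ : Fin Nf → ℝ) :
    Matrix (FermiIdx Nf S) (FermiIdx Nf S) ℂ :=
  Matrix.reindex quarkEquiv quarkEquiv <| Matrix.of fun v v' : QuarkVar Nf S =>
    if v.1 = v'.1 then qcdOverlapDirac U (μ v.1) v.2 v'.2 else 0

/-- **The overlap fermionic Boltzmann factor** `exp(−ψ̄ D(U) ψ)`, `D(U) = ⊕_f D_{μ_f}(U)`, as a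
Grassmann element — the overlap twin of `fermiBoltzmann`; the `let B` of the route
`OverlapPositivityTransfer`. [cite: MontvayMunster1994, §4.1 (4.14)–(4.17)] [cite: GiustiEtAl2002, §3 (massive Neuberger–Dirac operator)] -/
def overlapBoltzmann (U : GaugeConfig 4 S 𝔾) (μ : Fin Nf → ℝ) : FermiAlg Nf S :=
  grassmannExp (quadratic ℂ (-overlapDiracMatrix U μ))

/-! ### Lüscher's admissibility-constrained gauge weight (trace form, cut `δ = 1/1800`) -/

/-- **The single-plaquette admissible Boltzmann factor** at inverse coupling `β` as a function of
`t = Re tr(1 − Uₚ) = 3 − Re tr Uₚ`: `w_β(t) = exp(−β t/(1 − 1800 t))` if `t < 1/1800`, else `0` —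
the plaquette action `β t/(1 − t/δ)` diverging at the admissibility cut `δ = 1/1800`, `+∞` beyond
(Fukaya et al.: `s = t/3`, action `β' s/(1 − s/ε')`, so `ε' = 1/5400`, `β' = 3β`; Lüscher's abelian
prototype is `F²{1 − F²/ε²}⁻¹` under `|F| < ε`). As `‖1 − U‖² ≤ tr((1 − U)†(1 − U)) = 2 Re tr(1 − U)`
for unitary `U`, `t < 1/1800 = ε²/2` implies HJL's norm bound `‖1 − Uₚ‖ < ε = 1/30`. The body is
the `fun t => …` of the `let w` of the route `OverlapPositivityTransfer`.
[cite: FukayaEtAl2006, §2 eq. (2)] [cite: Luscher1999AbelianChiral, §2 eqs. (2.5)–(2.6) and (2.9)] [cite: HernandezJansenLuscher1999, eqs. (2.15)–(2.16) and §2.5 (ε < 1/30)] -/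
def overlapGaugeCut (β t : ℝ) : ℝ :=
  if t < 1 / 1800 then Real.exp (-(β * t / (1 - 1800 * t))) else 0

/-- **The admissible-overlap gauge weight of a configuration** (density against the product
Haar measure): `∏ₚ w_β(3 − Re tr Uₚ) = 1[U admissible] · exp(−β Σₚ tₚ/(1 − 1800 tₚ))` over all
plaquettes of the four-torus, `SU(3)` fundamental. Cast to `ℂ` it is the `let w` of the route
`OverlapPositivityTransfer`.
[cite: FukayaEtAl2006, §2 eq. (2)] [cite: Luscher1999AbelianChiral, §2 eqs. (2.5)–(2.6) and (2.9)] -/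
def overlapGaugeWeight (β : ℝ) (U : GaugeConfig 4 S 𝔾) : ℝ :=
  ∏ p : Plaquette 4 S,
    overlapGaugeCut β (3 - ((fundamentalRep (Fin 3)) (plaquetteHolonomy U p.1 p.2.1.1 p.2.1.2)).trace.re)

end OneTorus

variable {Nf : ℕ}

/-! ### The admissible-overlap lattice QCD expectation and the twins of the `QCDOS` clauses -/

/-- **The admissible-overlap lattice QCD partition function on the torus of side `S`** (up to the
orientation sign of `berezin`): `Z = ∫ ∏ₑdUₑ (∏ₚ w_β) ∫dψ̄dψ e^{−ψ̄D(U)ψ}` — the denominator of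
`overlapTorusExpect`. [cite: OsterwalderSeiler1978, §2] [cite: MontvayMunster1994, §4.1 and §5.1] -/
def overlapPartitionFn (β : ℝ) (S : ℕ) [NeZero S] (μ : Fin Nf → ℝ) : ℂ :=
  ∫ U, fermiIntegral (overlapBoltzmann U μ) * ((overlapGaugeWeight β U : ℝ) : ℂ)
    ∂(Measure.pi fun _ : Edge 4 S => haarProbability 𝔾)

/-- **Admissible-overlap lattice QCD expectation on the torus of side `S`** at inverse bare
coupling `β` and bare overlap masses `μ_f` of a Grassmann-valued function `X` of the gauge field:
`⟨X⟩ = ∫∏ₑdUₑ (∏ₚw_β) ∫dψ̄dψ X(U) e^{−ψ̄D(U)ψ} / ∫∏ₑdUₑ (∏ₚw_β) ∫dψ̄dψ e^{−ψ̄D(U)ψ}` — the overlap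
twin of `qcdTorusExpect` (same Berezin conventions; junk `0` if the denominator vanishes); the
`let ovE` of the route `OverlapPositivityTransfer`. [cite: OsterwalderSeiler1978, §2] [cite: MontvayMunster1994, §4.1 and §5.1] [cite: FukayaEtAl2006, §2 eq. (2)] -/
def overlapTorusExpect (β : ℝ) (S : ℕ) [NeZero S] (μ : Fin Nf → ℝ)
    (X : GaugeConfig 4 S 𝔾 → FermiAlg Nf S) : ℂ :=
  (∫ U, fermiIntegral (X U * overlapBoltzmann U μ) * ((overlapGaugeWeight β U : ℝ) : ℂ)
      ∂(Measure.pi fun _ : Edge 4 S => haarProbability 𝔾)) /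
    overlapPartitionFn β S μ

/-- **Connected Euclidean-time correlation of admissible-overlap lattice QCD on the torus of side
`S`**: `⟨A(0)·B(n e₀)⟩ − ⟨A(0)⟩⟨B(n e₀)⟩` — the overlap twin of `qcdLatticeConnectedCorr`.
[cite: OsterwalderSeiler1978, §§2–4] -/
def overlapLatticeConnectedCorr {R R' : ℕ} (β : ℝ) (S : ℕ) [NeZero S] (μ : Fin Nf → ℝ)
    (A : QCDLatticeObservable Nf R) (B : QCDLatticeObservable Nf R') (n : ℕ) : ℂ :=
  overlapTorusExpect β S μ (fun U => A.onTorus S 0 U * B.onTorus S (Pi.single 0 (n : ℤ)) U) -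
    overlapTorusExpect β S μ (A.onTorus S 0) *
      overlapTorusExpect β S μ (B.onTorus S (Pi.single 0 (n : ℤ)))

/-- **Uniform lattice mass gap `Δ` of admissible-overlap QCD along the scheme, uniformly in the
volume** — the overlap twin of `QCDScheme.HasLatticeMassGap` (same quantifier shape: all pairs of
gauge-invariant local lattice QCD observables, all large `k`, all tori `2S+1 ≥ 2L_k+1`, all
`n ≤ S`); the `let OvGap` of the route `OverlapPositivityTransfer`.
[cite: JaffeWitten2000, §1 and §5] [cite: OsterwalderSeiler1978, §§2–4] -/
def QCDScheme.OverlapHasLatticeMassGap (sch : QCDScheme Nf) (Δ : ℝ) : Prop :=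
  ∀ (R R' : ℕ) (A : QCDLatticeObservable Nf R) (B : QCDLatticeObservable Nf R'), ∃ C : ℝ,
    ∀ᶠ k in atTop, ∀ S : ℕ, sch.L k ≤ S → ∀ n : ℕ, n ≤ S →
      ‖overlapLatticeConnectedCorr (sch.β k) (2 * S + 1) (fun fl => sch.mq fl k) A B n‖ ≤
        C * Real.exp (-(Δ * (sch.a k * n)))

/-- **Admissible-overlap lattice QCD `n`-point function** of the species string `σ` on real test
functions `fᵢ` at step `k` of the scheme — the overlap twin of `qcdLatticeSchwinger` (same
`smearedInsertion`s, torus of side `sch.side k = 2L_k+1`). [cite: OsterwalderSeiler1978, §2] [cite: MontvayMunster1994, §4.1 and §5.1] -/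
def overlapLatticeSchwinger (sch : QCDScheme Nf) (k : ℕ) (n : ℕ) (σ : Fin n → QCDField Nf)
    (f : Fin n → 𝓢(EuclideanSpace ℝ (Fin 4), ℝ)) : ℂ :=
  overlapTorusExpect (sch.β k) (sch.side k) (fun fl => sch.mq fl k)
    (fun U => (List.ofFn fun i => smearedInsertion sch k U (σ i) (f i)).prod)

/-- **`IsOverlapQCDAlong sch T`** — the overlap twin of `IsQCDAlong`: two-loop asymptotic scaling of
the bare coupling, bare overlap masses EVENTUALLY IN `(0, 2)` (the interior of the range
`0 ≤ ām ≤ 2` of `(1 − m/2)D + m`: `μ = 0` is the massless GW operator, `μ = 2` the constant `2·1`;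
this replaces the Wilson physical-branch clause `m_f(k) > −1`), and convergence of the overlap
lattice `n`-point functions to `𝔖ₙ^σ(F)` on off-diagonal tensor test functions along `k → ∞`;
the `let OvAlong` of the route `OverlapPositivityTransfer`.
[cite: JaffeWitten2000, §1 and §5] [cite: OsterwalderSeiler1978, §2] [cite: GiustiEtAl2002, §3 (0 ≤ ām ≤ 2)] -/
def IsOverlapQCDAlong (sch : QCDScheme Nf) (T : OSData (QCDField Nf) 4) : Prop :=
  sch.HasAsymptoticScaling ∧
    (∀ fl : Fin Nf, ∀ᶠ k in atTop, 0 < sch.mq fl k ∧ sch.mq fl k < 2) ∧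
    ∀ (n : ℕ), n ≠ 0 → ∀ (σ : Fin n → QCDField Nf)
      (f : Fin n → 𝓢(EuclideanSpace ℝ (Fin 4), ℝ)) (F : 𝓢((Fin n → EuclideanSpace ℝ (Fin 4)), ℂ)),
      IsTensorOf F (fun i => ofRealTest (f i)) → IsOffDiagonal F →
        Tendsto (fun k : ℕ => overlapLatticeSchwinger sch k n σ f) atTop (𝓝 (T.schwinger n σ F))

/-- **`OverlapQCDOf N_f`** — the overlap twin of the sub-problem statement `QCDOf N_f` (same
`QCDRegularisation`/`HasMassScaling` data, same species, non-triviality, non-Gaussianity,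
dynamical-flavour and mass-gap clauses, with `IsQCDAlong ↦ IsOverlapQCDAlong` and
`HasLatticeMassGap ↦ OverlapHasLatticeMassGap`); the `let Ov` of the route
`OverlapPositivityTransfer`. PRE-RE-TYPE shape (no chiral clause): since the statement re-type of
2026-08-16 the twin of `QCDOf N_f` is `OverlapChiralQCDOf N_f` (below), of which this is the
forgetful image (`OverlapChiralQCDOf.overlapQCDOf`). [cite: JaffeWitten2000, §1 and §5] [cite: GiustiEtAl2002, §3 (massive Neuberger–Dirac operator)] -/
def OverlapQCDOf (Nf : ℕ) : Prop :=
  ∃ reg : QCDRegularisation Nf, reg.HasMassScaling ∧ ∀ m : Fin Nf → ℝ, (∀ f, 0 < m f) →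
    ∃ (z shift : QCDField Nf → ℕ → ℝ) (T : OSData (QCDField Nf) 4),
      IsOverlapQCDAlong (reg.scheme m z shift) T ∧ T.IsNontrivial QCDField.glue ∧
        T.IsNonGaussian QCDField.glue ∧
          (∀ f g : Fin Nf, f ≠ g → T.IsNontrivial (QCDField.pseudoRe f g)) ∧
            ∃ Δ > 0, T.HasMassGap Δ ∧ (reg.scheme m z shift).OverlapHasLatticeMassGap Δ

/-- **The overlap lattice-gap package** (the `let GapPkg` of the route items `OverlapLatticeGap` /
`OverlapContinuumLimit`): one regularisation with mass scaling such that for every positive mass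
tuple the un-renormalised scheme `reg.scheme m 0 0` scales asymptotically, has bare overlap masses
eventually in `(0, 2)`, and a uniform overlap-lattice gap — `∃ reg, reg.HasMassScaling ∧
reg.HasOverlapGapAtPositiveMass` (`overlapGapPackage_iff`); the chiral refinement is
`OverlapChiralGapPackage` (below). [cite: JaffeWitten2000, §5] -/
def OverlapGapPackage (Nf : ℕ) : Prop :=
  ∃ reg : QCDRegularisation Nf, reg.HasMassScaling ∧ ∀ m : Fin Nf → ℝ, (∀ f, 0 < m f) →
    (reg.scheme m 0 0).HasAsymptoticScaling ∧
      (∀ fl : Fin Nf, ∀ᶠ k in atTop,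
          0 < (reg.scheme m 0 0).mq fl k ∧ (reg.scheme m 0 0).mq fl k < 2) ∧
        ∃ Δ > 0, (reg.scheme m 0 0).OverlapHasLatticeMassGap Δ

/-! ### The chiral point (statement re-type 2026-08-16): overlap twins of `IsChiralAtZero` -/

section ChiralPoint

/-- **Chirality at zero of an overlap regularisation** — the LITERAL overlap twin of
`QCDRegularisation.IsChiralAtZero` (`HasLatticeMassGap ↦ OverlapHasLatticeMassGap`): for every
`ε > 0` some tuple of POSITIVE renormalised quark masses has NO uniform overlap-lattice gap `ε`
along the bare trajectory `μ_f(k) = m_crit(k) + a_k m_f / Z_m(k)` (the clause reads only `β_k`,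
`μ_f(k)`, `L_k`, `a_k`, so `z = shift = 0`): the overlap lattice gap closes as `m → 0⁺`. In the
overlap world the chiral point is canonical — Lüscher's exact flavoured chiral symmetry at `μ = 0`
forbids an additive mass renormalisation, so the honest regularisation has `m_crit ≡ 0` — and the
clause is Goldstone's alternative: by the exact flavoured Ward identity
`G_ab(p = 0) = δ_ab ⟨Ψ̄(1 − aD/2)Ψ⟩/(m a⁴)` a uniform gap down to `μ = 0⁺` would force the
condensate to vanish in the chiral limit. [cite: Chandrasekharan1999, §3 (zero-momentum flavoured pion correlator G_ab = δ_ab⟨Ψ̄(1−aD/2)Ψ⟩/(m a⁴); m_π² ∝ m)] [cite: Luscher1998, §4 eq. (4.1) (exact flavour non-singlet lattice chiral symmetry of Ginsparg–Wilson fermions)] [cite: MontvayMunster1994, §5.1 (critical hopping parameter, (5.82)–(5.91))] [cite: JaffeWitten2000, §5] -/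
def QCDRegularisation.OverlapIsChiralAtZero (reg : QCDRegularisation Nf) : Prop :=
  ∀ ε > (0 : ℝ), ∃ m : Fin Nf → ℝ, (∀ f, 0 < m f) ∧ ¬ (reg.scheme m 0 0).OverlapHasLatticeMassGap ε

/-- **The overlap lattice gap closes at zero mass AT EVERY LARGE CUTOFF** — the subsequence-stable
strengthening of `OverlapIsChiralAtZero` (`OverlapGapClosesAtZero.overlapIsChiralAtZero`): for
every rate `ε > 0` there are a positive renormalised mass tuple `m` and ONE pair of gauge-invariant
local lattice observables `A, B` (a pion interpolator) such that for every constant `C`,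
EVENTUALLY in `k` (not merely frequently), on some torus `2S+1 ≥ 2L_k+1` and at some Euclidean time
`n ≤ S`, the connected overlap correlation exceeds the gap bound `C e^{−ε a_k n}`. This is what the
physics gives (at fixed small `m` the pion of the step-`k` lattice theory is lighter than `ε` for
ALL large `k`, and `S`, `n` are free at fixed `k`), and unlike the literal clause (a negated
`∀ᶠ`, i.e. a `∃ᶠ`) it survives every reindexing `k ↦ φ(k)`, `φ` strictly monotone — the operation
a compactness proof of the continuum limit performs. [cite: Chandrasekharan1999, §3 (m_π² ∝ m for Ginsparg–Wilson fermions)] [cite: JaffeWitten2000, §5] -/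
def QCDRegularisation.OverlapGapClosesAtZero (reg : QCDRegularisation Nf) : Prop :=
  ∀ ε > (0 : ℝ), ∃ m : Fin Nf → ℝ, (∀ f, 0 < m f) ∧
    ∃ (R R' : ℕ) (A : QCDLatticeObservable Nf R) (B : QCDLatticeObservable Nf R'),
      ∀ C : ℝ, ∀ᶠ k in atTop, ∃ S : ℕ, (reg.scheme m 0 0).L k ≤ S ∧ ∃ n : ℕ, n ≤ S ∧
        C * Real.exp (-(ε * ((reg.scheme m 0 0).a k * n))) <
          ‖overlapLatticeConnectedCorr ((reg.scheme m 0 0).β k) (2 * S + 1)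
              (fun fl => (reg.scheme m 0 0).mq fl k) A B n‖

/-- **The positive-mass body of the overlap gap package** as a property of ONE regularisation:
for every positive renormalised mass tuple the un-renormalised scheme `reg.scheme m 0 0` scales
asymptotically, has bare overlap masses eventually in `(0, 2)`, and a uniform overlap-lattice gap
(so that `OverlapGapPackage N_f ↔ ∃ reg, reg.HasMassScaling ∧ reg.HasOverlapGapAtPositiveMass`,
`overlapGapPackage_iff`). [cite: JaffeWitten2000, §5] -/
def QCDRegularisation.HasOverlapGapAtPositiveMass (reg : QCDRegularisation Nf) : Prop :=
  ∀ m : Fin Nf → ℝ, (∀ f, 0 < m f) →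
    (reg.scheme m 0 0).HasAsymptoticScaling ∧
      (∀ fl : Fin Nf, ∀ᶠ k in atTop,
          0 < (reg.scheme m 0 0).mq fl k ∧ (reg.scheme m 0 0).mq fl k < 2) ∧
        ∃ Δ > 0, (reg.scheme m 0 0).OverlapHasLatticeMassGap Δ

/-- **`OverlapChiralQCDOf N_f`** — the overlap twin of the RE-TYPED sub-problem statement
`QCDOf N_f` (2026-08-16: `∃ reg, reg.HasMassScaling ∧ reg.IsChiralAtZero ∧ ∀ m > 0, …`), with the
chiral clause in its subsequence-stable form `OverlapGapClosesAtZero` (hence also the literal twin,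
`OverlapChiralQCDOf.overlapIsChiralAtZero`) and otherwise the body of `OverlapQCDOf`
(`IsOverlapQCDAlong`, non-trivial non-Gaussian glue, dynamical flavours, `T.HasMassGap Δ` and the
overlap-lattice gap at the same `Δ`). [cite: JaffeWitten2000, §1 and §5] [cite: GiustiEtAl2002, §3 (massive Neuberger–Dirac operator)] [cite: Chandrasekharan1999, §3 (m_π² ∝ m for Ginsparg–Wilson fermions)] -/
def OverlapChiralQCDOf (Nf : ℕ) : Prop :=
  ∃ reg : QCDRegularisation Nf, reg.HasMassScaling ∧ reg.OverlapGapClosesAtZero ∧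
    ∀ m : Fin Nf → ℝ, (∀ f, 0 < m f) →
      ∃ (z shift : QCDField Nf → ℕ → ℝ) (T : OSData (QCDField Nf) 4),
        IsOverlapQCDAlong (reg.scheme m z shift) T ∧ T.IsNontrivial QCDField.glue ∧
          T.IsNonGaussian QCDField.glue ∧
            (∀ f g : Fin Nf, f ≠ g → T.IsNontrivial (QCDField.pseudoRe f g)) ∧
              ∃ Δ > 0, T.HasMassGap Δ ∧ (reg.scheme m z shift).OverlapHasLatticeMassGap Δ

/-- **The chiral overlap lattice-gap package**: ONE regularisation with leading-log mass scaling
whose overlap lattice gap closes at zero mass at every large cutoff AND which has, for every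
positive renormalised mass tuple, asymptotic scaling, bare overlap masses eventually in `(0, 2)`
and a uniform overlap-lattice gap — "the overlap lattice theory is gapped exactly at positive
quark mass". [cite: JaffeWitten2000, §5] [cite: Chandrasekharan1999, §3 (m_π² ∝ m for Ginsparg–Wilson fermions)] -/
def OverlapChiralGapPackage (Nf : ℕ) : Prop :=
  ∃ reg : QCDRegularisation Nf, reg.HasMassScaling ∧ reg.OverlapGapClosesAtZero ∧
    reg.HasOverlapGapAtPositiveMass

/-- The pre-re-type package is `∃ reg, reg.HasMassScaling ∧ reg.HasOverlapGapAtPositiveMass`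
(definitional). [folklore] -/
theorem overlapGapPackage_iff (Nf : ℕ) :
    OverlapGapPackage Nf ↔
      ∃ reg : QCDRegularisation Nf, reg.HasMassScaling ∧ reg.HasOverlapGapAtPositiveMass :=
  Iff.rfl

/-- **Closing at every large cutoff implies the literal chiral clause**: if the gap bound fails
eventually in `k` it fails at some `k` beyond any threshold of a putative uniform gap. [folklore] -/
theorem QCDRegularisation.OverlapGapClosesAtZero.overlapIsChiralAtZero {reg : QCDRegularisation Nf}
    (h : reg.OverlapGapClosesAtZero) : reg.OverlapIsChiralAtZero := by
  intro ε hε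
  obtain ⟨m, hm, R, R', A, B, hAB⟩ := h ε hε
  refine ⟨m, hm, fun hgap => ?_⟩
  obtain ⟨C, hC⟩ := hgap R R' A B
  obtain ⟨k, hk₁, S, hS, n, hn, hlt⟩ := (hC.and (hAB C)).exists
  exact absurd (hk₁ S hS n hn) (not_le.2 hlt)

/-- A uniform overlap-lattice gap at all positive mass tuples refutes the chiral clause (the
overlap twin of the Wilson-side `not_isChiralAtZero_of_uniform_gap`). [folklore] -/
theorem QCDRegularisation.not_overlapIsChiralAtZero_of_uniform_gap {reg : QCDRegularisation Nf}
    (h : ∃ ε : ℝ, 0 < ε ∧ ∀ m : Fin Nf → ℝ, (∀ f, 0 < m f) →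
      (reg.scheme m 0 0).OverlapHasLatticeMassGap ε) :
    ¬ reg.OverlapIsChiralAtZero := by
  rintro hχ
  obtain ⟨ε, hε, hgap⟩ := h
  obtain ⟨m, hm, hng⟩ := hχ ε hε
  exact hng (hgap m hm)

/-- The chiral twin carries the literal twin of the re-typed clause pair
`reg.HasMassScaling ∧ reg.IsChiralAtZero`. [folklore] -/
theorem OverlapChiralQCDOf.overlapIsChiralAtZero (h : OverlapChiralQCDOf Nf) :
    ∃ reg : QCDRegularisation Nf, reg.HasMassScaling ∧ reg.OverlapIsChiralAtZero := by
  obtain ⟨reg, hMS, hχ, -⟩ := h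
  exact ⟨reg, hMS, hχ.overlapIsChiralAtZero⟩

/-- The chiral twin forgets to the pre-re-type twin. [folklore] -/
theorem OverlapChiralQCDOf.overlapQCDOf (h : OverlapChiralQCDOf Nf) : OverlapQCDOf Nf := by
  obtain ⟨reg, hMS, -, hbody⟩ := h
  exact ⟨reg, hMS, hbody⟩

/-- The chiral package forgets to the pre-re-type package. [folklore] -/
theorem OverlapChiralGapPackage.overlapGapPackage (h : OverlapChiralGapPackage Nf) :
    OverlapGapPackage Nf := by
  obtain ⟨reg, hMS, -, hbody⟩ := h
  exact ⟨reg, hMS, hbody⟩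

end ChiralPoint

/-! ### API: the admissible weight -/

/-- The cut weight is non-negative. [folklore] -/
theorem overlapGaugeCut_nonneg (β t : ℝ) : 0 ≤ overlapGaugeCut β t := by
  unfold overlapGaugeCut
  split_ifs
  · exact (Real.exp_pos _).le
  · exact le_rfl

/-- The cut weight is positive exactly on the admissible range `t < 1/1800`. [cite: Luscher1999AbelianChiral, §2 (2.9)] -/
theorem overlapGaugeCut_pos_iff (β t : ℝ) : 0 < overlapGaugeCut β t ↔ t < 1 / 1800 := by
  unfold overlapGaugeCut
  split_ifs with h
  · exact ⟨fun _ => h, fun _ => Real.exp_pos _⟩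
  · exact ⟨fun h0 => (lt_irrefl _ h0).elim, fun h' => (h h').elim⟩

/-- On the admissible range the cut weight is the Boltzmann factor of the modified plaquette
action `β t/(1 − 1800 t)`. [cite: FukayaEtAl2006, §2 eq. (2)] -/
theorem overlapGaugeCut_of_lt (β : ℝ) {t : ℝ} (ht : t < 1 / 1800) :
    overlapGaugeCut β t = Real.exp (-(β * t / (1 - 1800 * t))) := by
  unfold overlapGaugeCut
  rw [if_pos ht]

/-- For `β ≥ 0` and `t ≥ 0` (i.e. `Re tr Uₚ ≤ 3`) the cut weight is at most `1`. [folklore] -/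
theorem overlapGaugeCut_le_one {β t : ℝ} (hβ : 0 ≤ β) (ht : 0 ≤ t) : overlapGaugeCut β t ≤ 1 := by
  unfold overlapGaugeCut
  split_ifs with h
  · rw [Real.exp_le_one_iff, neg_nonpos]
    have h1 : 0 < 1 - 1800 * t := by linarith
    exact div_nonneg (mul_nonneg hβ ht) h1.le
  · exact zero_le_one

/-- `Re tr U ≤ 3` for `U ∈ SU(3)` (entries of a unitary matrix are bounded by `1`). [folklore] -/
theorem re_trace_fundamentalRep_le_three (g : 𝔾) : ((fundamentalRep (Fin 3)) g).trace.re ≤ 3 := by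
  have hU := fundamentalRep_mem_unitaryGroup g
  rw [Matrix.trace, Complex.re_sum]
  calc ∑ a, (Matrix.diag ((fundamentalRep (Fin 3)) g) a).re
      ≤ ∑ _a : Fin 3, (1 : ℝ) := Finset.sum_le_sum fun a _ =>
        ((le_abs_self _).trans (Complex.abs_re_le_norm _)).trans (entry_norm_bound_of_unitary hU a a)
    _ = 3 := by simp

section OneTorus

variable {S : ℕ} [NeZero S]

/-- The admissible gauge weight is non-negative. [folklore] -/
theorem overlapGaugeWeight_nonneg (β : ℝ) (U : GaugeConfig 4 S 𝔾) : 0 ≤ overlapGaugeWeight β U :=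
  Finset.prod_nonneg fun _ _ => overlapGaugeCut_nonneg _ _

/-- The admissible gauge weight is positive exactly on Lüscher's admissible set
`{U | ∀ p, Re tr(1 − Uₚ) < 1/1800}` (and vanishes off it). [cite: Luscher1999AbelianChiral, §2 (2.9)] -/
theorem overlapGaugeWeight_pos_iff (β : ℝ) (U : GaugeConfig 4 S 𝔾) :
    0 < overlapGaugeWeight β U ↔ ∀ p : Plaquette 4 S,
      3 - ((fundamentalRep (Fin 3)) (plaquetteHolonomy U p.1 p.2.1.1 p.2.1.2)).trace.re < 1 / 1800 := by
  unfold overlapGaugeWeight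
  constructor
  · intro h p
    have hp : overlapGaugeCut β
        (3 - ((fundamentalRep (Fin 3)) (plaquetteHolonomy U p.1 p.2.1.1 p.2.1.2)).trace.re) ≠ 0 :=
      fun h0 => absurd (Finset.prod_eq_zero (Finset.mem_univ p) h0) h.ne'
    exact (overlapGaugeCut_pos_iff β _).1
      (lt_of_le_of_ne (overlapGaugeCut_nonneg _ _) (Ne.symm hp))
  · intro h
    exact Finset.prod_pos fun p _ => (overlapGaugeCut_pos_iff β _).2 (h p)

/-- For `β ≥ 0` the admissible gauge weight is at most `1` (a sub-probability density against
the product Haar measure). [folklore] -/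
theorem overlapGaugeWeight_le_one {β : ℝ} (hβ : 0 ≤ β) (U : GaugeConfig 4 S 𝔾) :
    overlapGaugeWeight β U ≤ 1 :=
  Finset.prod_le_one (fun _ _ => overlapGaugeCut_nonneg _ _) fun _ _ =>
    overlapGaugeCut_le_one hβ (sub_nonneg.2 (re_trace_fundamentalRep_le_three _))

/-- **Gauge invariance of the admissible weight**: the plaquette holonomy transforms by
conjugation and the trace is cyclic, so `w_β(U^g) = w_β(U)` — the weight is a product of local
gauge-invariant plaquette factors. [cite: Luscher1999AbelianChiral, §2 (2.5)–(2.6) and remark (a)] -/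
theorem overlapGaugeWeight_gaugeTransform (β : ℝ) (g : TorusSite 4 S → 𝔾) (U : GaugeConfig 4 S 𝔾) :
    overlapGaugeWeight β (gaugeTransform g U) = overlapGaugeWeight β U := by
  have hhol : ∀ (x : TorusSite 4 S) (i j : Fin 4), plaquetteHolonomy (gaugeTransform g U) x i j =
      g x * plaquetteHolonomy U x i j * (g x)⁻¹ := fun x i j => by
    have hshift : QuantumFieldTheory.Site.shift (QuantumFieldTheory.Site.shift x j) i =
        QuantumFieldTheory.Site.shift (QuantumFieldTheory.Site.shift x i) j := by
      simp only [QuantumFieldTheory.Site.shift, add_assoc,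
        add_comm (Pi.single (M := fun _ => ZMod S) j 1)]
    simp only [plaquetteHolonomy, gaugeTransform, hshift, mul_inv_rev, inv_inv]
    group
  have htr : ∀ a b : 𝔾, ((fundamentalRep (Fin 3)) (a * b * a⁻¹)).trace =
      ((fundamentalRep (Fin 3)) b).trace := fun a b => by
    rw [map_mul, map_mul, Matrix.trace_mul_cycle, ← map_mul, inv_mul_cancel, map_one, one_mul]
  simp only [overlapGaugeWeight, hhol, htr]

/-! ### API: the overlap fermion matrix and its Berezin integral -/

/-- **Flavour factorisation**: the `N_f`-flavour overlap fermion matrix is block-diagonal in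
flavour, so `det D(U) = ∏_f det D_{μ_f}(U)`. [cite: MontvayMunster1994, §5.1] -/
theorem det_overlapDiracMatrix (U : GaugeConfig 4 S 𝔾) (μ : Fin Nf → ℝ) :
    (overlapDiracMatrix U μ).det = ∏ f, (qcdOverlapDirac U (μ f)).det := by
  have hb : (Matrix.of fun v v' : QuarkVar Nf S =>
      if v.1 = v'.1 then qcdOverlapDirac U (μ v.1) v.2 v'.2 else 0) =
      Matrix.reindex (Equiv.prodComm _ _) (Equiv.prodComm _ _)
        (Matrix.blockDiagonal fun f => qcdOverlapDirac U (μ f)) := by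
    ext ⟨f, i⟩ ⟨f', i'⟩
    simp [Matrix.blockDiagonal_apply']
  unfold overlapDiracMatrix
  rw [hb, Matrix.det_reindex_self, Matrix.det_reindex_self, Matrix.det_blockDiagonal]

/-- **Gaussian Berezin evaluation of the overlap Boltzmann factor** (clause (ii) of the route item
`OverlapMeasurePositivity`): `∫dψ̄dψ e^{−ψ̄D(U)ψ} = (−1)^{n(n−1)/2 + n} ∏_f det D_{μ_f}(U)`,
`n = #quark variables` — the tree's Gaussian formula `berezin_grassmannExp_quadratic_holds`
(orientation sign `(−1)^{n(n−1)/2}`), `det(−D) = (−1)ⁿ det D`, and flavour factorisation.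
[cite: MontvayMunster1994, §4.1 (4.17) and (4.22)] [cite: Berezin1966, Ch. I §3] -/
theorem fermiIntegral_overlapBoltzmann (U : GaugeConfig 4 S 𝔾) (μ : Fin Nf → ℝ) :
    fermiIntegral (overlapBoltzmann U μ) =
      (-1 : ℂ) ^ (Fintype.card (FermiIdx Nf S) * (Fintype.card (FermiIdx Nf S) - 1) / 2 +
          Fintype.card (FermiIdx Nf S)) *
        ∏ f, (qcdOverlapDirac U (μ f)).det := by
  rw [fermiIntegral, overlapBoltzmann,
    berezin_grassmannExp_quadratic_holds ℂ (-overlapDiracMatrix U μ), Matrix.det_neg,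
    det_overlapDiracMatrix, pow_add, mul_assoc]

end OneTorus

/-- **Determinant form of the overlap partition function**:
`Z = (−1)^{n(n−1)/2+n} ∫ ∏ₑdUₑ (∏_f det D_{μ_f}(U)) ∏ₚ w_β(Uₚ)` — the quantity whose strict
positivity for `β ≥ 0`, `μ_f > 0` is the route item `OverlapMeasurePositivity`. [cite: MontvayMunster1994, §5.1 (effective gauge action with the fermion determinant)] -/
theorem overlapPartitionFn_eq (β : ℝ) (S : ℕ) [NeZero S] (μ : Fin Nf → ℝ) :
    overlapPartitionFn β S μ =
      (-1 : ℂ) ^ (Fintype.card (FermiIdx Nf S) * (Fintype.card (FermiIdx Nf S) - 1) / 2 +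
          Fintype.card (FermiIdx Nf S)) *
        ∫ U, (∏ f, (qcdOverlapDirac U (μ f)).det) * ((overlapGaugeWeight β U : ℝ) : ℂ)
          ∂(Measure.pi fun _ : Edge 4 S => haarProbability 𝔾) := by
  simp_rw [overlapPartitionFn, fermiIntegral_overlapBoltzmann, mul_assoc]
  exact integral_const_mul _ _

/-! ### API: the expectation functional -/

/-- **`⟨1⟩ = 1`** whenever the partition function does not vanish (it is strictly positive for
`β ≥ 0`, `μ_f > 0`: route item `OverlapMeasurePositivity`). [cite: OsterwalderSeiler1978, §2] -/
theorem overlapTorusExpect_one {β : ℝ} {S : ℕ} [NeZero S] {μ : Fin Nf → ℝ}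
    (hZ : overlapPartitionFn β S μ ≠ 0) :
    overlapTorusExpect β S μ (fun _ => 1) = 1 := by
  simp only [overlapTorusExpect, one_mul]
  exact div_self hZ

/-- **Homogeneity** of the overlap expectation in the insertion: `⟨c X⟩ = c ⟨X⟩`. [folklore] -/
theorem overlapTorusExpect_smul (β : ℝ) (S : ℕ) [NeZero S] (μ : Fin Nf → ℝ) (c : ℂ)
    (X : GaugeConfig 4 S 𝔾 → FermiAlg Nf S) :
    overlapTorusExpect β S μ (fun U => c • X U) = c * overlapTorusExpect β S μ X := by
  simp only [overlapTorusExpect, smul_mul_assoc, map_smul, smul_eq_mul, mul_assoc]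
  rw [integral_const_mul, mul_div_assoc]

/-! ### API: the scheme-level clauses -/

variable (Nf) in
/-- The scheme with unit bare overlap masses, `z ≡ 0`, and the asymptotically scaling couplings
of `QCDScheme.zeroAF` (non-vacuity witness for `IsOverlapQCDAlong`). [folklore] -/
def QCDScheme.unitMassAF : QCDScheme Nf :=
  { QCDScheme.zeroAF Nf with mq := fun _ _ => 1 }

/-- `QCDScheme.unitMassAF` has `z ≡ 0`. [folklore] -/
@[simp] theorem QCDScheme.unitMassAF_z (s : QCDField Nf) (k : ℕ) :
    (QCDScheme.unitMassAF Nf).z s k = 0 := rfl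

/-- `QCDScheme.unitMassAF` has unit bare overlap masses. [folklore] -/
@[simp] theorem QCDScheme.unitMassAF_mq (fl : Fin Nf) (k : ℕ) :
    (QCDScheme.unitMassAF Nf).mq fl k = 1 := rfl

/-- `QCDScheme.unitMassAF` scales asymptotically (with `Λ = 1`, as `zeroAF`). [folklore] -/
theorem QCDScheme.unitMassAF_hasAsymptoticScaling :
    (QCDScheme.unitMassAF Nf).HasAsymptoticScaling :=
  ⟨1, one_pos, by simp [QCDScheme.unitMassAF, QCDScheme.zeroAF]⟩

/-- **Non-vacuity of the placeholder `IsOverlapQCDAlong`**: with `z ≡ 0` every overlap lattice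
`n`-point function (`n ≥ 1`) vanishes (the first smeared insertion is `0`), the unit bare masses
lie in `(0, 2)`, and the couplings scale asymptotically — so the vacuum-only OS data are
"overlap QCD" in the placeholder sense (whence the non-triviality clauses of `OverlapQCDOf`).
[folklore] -/
theorem isOverlapQCDAlong_unitMassAF_vacuum (Nf : ℕ) :
    IsOverlapQCDAlong (QCDScheme.unitMassAF Nf) (OSData.vacuum (QCDField Nf) 4) := by
  refine ⟨QCDScheme.unitMassAF_hasAsymptoticScaling,
    fun _ => Eventually.of_forall fun _ => by norm_num, fun n hn σ f F _ _ => ?_⟩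
  have hS : (OSData.vacuum (QCDField Nf) 4).schwinger n σ F = 0 := by
    simp [OSData.vacuum, LabelledSchwingerFamily.trivial_of_ne_zero (QCDField Nf) hn]
  rw [hS]
  refine tendsto_const_nhds.congr' (Eventually.of_forall fun k => ?_)
  obtain ⟨j, rfl⟩ := Nat.exists_eq_succ_of_ne_zero hn
  simp [overlapLatticeSchwinger, overlapTorusExpect, smearedInsertion, List.ofFn_succ]

end Literature.MathematicalPhysics.QuantumFieldTheory

end
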